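import Summits.RiemannHypothesis.RiemannHypothesis.Theorems.PfPersistenceEdgeLaw
import Summits.RiemannHypothesis.RiemannHypothesis.Theorems.PfPersistenceArchVirial
import Summits.RiemannHypothesis.RiemannHypothesis.Theorems.PfPersistencePoleDeriv
import HarnessLib

/-!
# PF persistence — the dilation profile of a ground state is differentiable (small windows)

Support file for the crux `EvenSectorBarta.EvenOneSignedWindows` (pub-rhpf campaign, THEORY 1:
the Hadamard edge law; mechanism statements only, no claim about RH). Assembly of
`PfPersistenceArchVirial` (archimedean part), `PfPersistencePoleDeriv` (pole, prime, mass parts)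
and `PfPersistenceEdgeLaw` (the envelope argument):

* `hasDerivAt_weilDilationProfile_of_lt`: for a ground state `u` of a window `a < ½ log 2` (no
  prime-power length inside the doubled window's support scale: the prime part is locally constant
  along dilations) the dilation profile `η ↦ P(ũ_η) + 𝓔_{2a}(ũ_η) − M_{2a}‖ũ_η‖²` is differentiable
  at `η = 0`, with derivative the DILATION VIRIAL
  `V(u) = (pole virial) − ∫₀^∞ (tρ)'(s) D_s(ũ) ds`;
* `mul_deriv_weilGroundEnergy_eq_neg_virial_of_lt`: hence the **edge law in virial form**
  `a ε'(a) = −V(u)` at every differentiability point `a < ½ log 2` of `ε`, for EVERY ground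
  state `u` of the window — and at almost every such `a` unconditionally
  (`ae_mul_deriv_weilGroundEnergy_eq_neg_virial`).

For windows `a ≥ ½ log 2` the same conclusion needs the differentiability of the prime part
`Σ_{log n < 4a} Λ(n) n^{-1/2} D_{(1+η) log n}(ũ)` in `η`, i.e. interior regularity of `u` at the
prime-power lengths — hypothesis `(h-vir)` of THEORY-EDGE-3.md, not proved here.
-/

set_option linter.dupNamespace false

noncomputable section

open MeasureTheory Set Filter
open scoped Topology

namespace Summit.RiemannHypothesis.RiemannHypothesis.Theorems.PfPersistence

open Literature.NumberTheory.LFunctions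
open Summit.RiemannHypothesis.RiemannHypothesis.Theorems.WeilWindowFlowWindowLipschitz

/-- The **dilation virial** of a window state `u` of the window `a` (small-window form): the
`η`-derivative at `0` of the pole form along the dilates of `ũ = 1_{(-a,a)} u`, minus the archimedean
virial `∫₀^∞ (tρ)'(s) D_s(ũ) ds`. -/
def weilSmallWindowVirial (a : ℝ) (u : ℝ → ℂ) : ℝ :=
  deriv (fun η : ℝ ↦ weilPoleForm (weilDilate η (weilTrunc a u))) 0 -
    ∫ s in Ioi (0 : ℝ), weilArchVirialDensity s * weilIncrement (weilTrunc a u) s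

/-- **The dilation profile of a ground state of a window `a < ½ log 2` is differentiable at
`η = 0`**, with derivative `weilSmallWindowVirial a u`. [folklore] -/
theorem hasDerivAt_weilDilationProfile_of_lt {a : ℝ} {u : ℝ → ℂ} (hu : IsWeilGroundState a u)
    (ha2 : a < Real.log 2 / 2) :
    HasDerivAt (weilDilationProfile a u) (weilSmallWindowVirial a u) 0 := by
  set f := weilTrunc a u with hf_def
  have hvg : IsWeilGroundState a f := isWeilGroundState_weilTrunc hu
  have hf : MemLp f 2 := hvg.memLp
  have hfs : ∀ x, a ≤ |x| → f x = 0 := fun x hx ↦ weilTrunc_eq_zero u hx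
  have hE := (stub_groundStateEnergy a _ hvg).1
  have hA : ∀ n ∈ weilPrimeIndex (2 * a), 2 ≤ n → 2 * a < Real.log n := fun n _ hn ↦ by
    have h2 : Real.log 2 ≤ Real.log n :=
      Real.log_le_log two_pos (by exact_mod_cast hn)
    linarith
  have hP := (differentiableAt_weilPoleForm_weilDilate hf hfs).hasDerivAt
  have hPr := hasDerivAt_primeEnergy_weilDilate hf hfs hA
  have hAr := hasDerivAt_archEnergy_weilDilate hf hE
  have hM := hasDerivAt_mass_weilDilate f
  have e : weilDilationProfile a u = fun η ↦ weilPoleForm (weilDilate η f) +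
      ((∑ n ∈ weilPrimeIndex (2 * a), (ArithmeticFunction.vonMangoldt n : ℝ) / Real.sqrt n *
          weilIncrement (weilDilate η f) (Real.log n)) +
        ∫ t in Ioi (0 : ℝ), weilArchDensity t * weilIncrement (weilDilate η f) t) -
      weilMarkovConstant (2 * a) * ∫ x, ‖weilDilate η f x‖ ^ 2 := by
    funext η
    rfl
  rw [e]
  refine ((hP.add (hPr.add hAr)).sub (hM.const_mul _)).congr_deriv ?_
  simp only [weilSmallWindowVirial, hf_def]
  ring

/-- **Edge law in virial form, small windows**: for a ground state `u` of a window `a < ½ log 2`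
at which `ε` is differentiable, `a ε'(a) = −V(u)`. In particular `V(u)` does not depend on the
choice of the ground state. [folklore] -/
theorem mul_deriv_weilGroundEnergy_eq_neg_virial_of_lt {a : ℝ} {u : ℝ → ℂ}
    (hu : IsWeilGroundState a u) (ha2 : a < Real.log 2 / 2)
    (hd : DifferentiableAt ℝ weilGroundEnergy a) :
    a * deriv weilGroundEnergy a = -weilSmallWindowVirial a u :=
  mul_deriv_weilGroundEnergy_eq_neg hu hd (hasDerivAt_weilDilationProfile_of_lt hu ha2)

/-- **Edge law in virial form, unconditionally at almost every small window**: for a.e.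
`a ∈ (0, ½ log 2)` and EVERY ground state `u` of the window `a`, `a ε'(a) = −V(u)`. [folklore] -/
theorem ae_mul_deriv_weilGroundEnergy_eq_neg_virial :
    ∀ᵐ a : ℝ, 0 < a → a < Real.log 2 / 2 → ∀ u : ℝ → ℂ, IsWeilGroundState a u →
      a * deriv weilGroundEnergy a = -weilSmallWindowVirial a u := by
  filter_upwards [ae_mul_deriv_weilGroundEnergy_eq_neg] with a h ha ha2 u hu
  exact h ha u _ hu (hasDerivAt_weilDilationProfile_of_lt hu ha2)

end Summit.RiemannHypothesis.RiemannHypothesis.Theorems.PfPersistence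

end
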